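import Literature.Topology.FourManifolds.RegularLevelSplitting
import Literature.Topology.FourManifolds.SPC4HandleChainProofs
import Literature.Topology.FourManifolds.MorseExtrema
import Mathlib.Geometry.Manifold.Immersion
import Mathlib.LinearAlgebra.FiniteDimensional.Basic
import HarnessLib

/-!
# Immersions have injective differential (with boundary); orientations pull back along
immersions; interior minima of Morse functions; connected sublevel sets

Topic `Literature/Topology/FourManifolds`; general lemmas written for the fact seat
`provefact-Literature.Topology.FourManifolds.IsHandlebody.exists_diffeomorph_isBoundaryGluing_sphere`
(the inductive cutting of a handlebody below its top critical point,
`HandlebodyClassification.lean`). Everything here is **proved**.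

* `Literature.Topology.FourManifolds.injective_mfderiv_of_isImmersionAtOfComplement'`,
  `…_of_isImmersionAt'` — **the differential of a `C^∞` immersion is injective, also at boundary
  points.** The tree's `Literature.Topology.FourManifolds.mfderiv_injective_of_isImmersionAtOfComplement`
  (`DehnSurgeryTubularNbhdProofs.lean`) assumes a boundaryless source model (it differentiates
  the inverse extended chart on an open subset of the model vector space). Here instead `f` is
  factored near `x` as `ψ⁻¹ ∘ g ∘ φ` through the slice charts `φ`, `ψ` of the *maximal* atlases
  and the map `g = ψ ∘ f ∘ φ⁻¹` *between the model spaces*, whose manifold derivative within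
  `range I` is the linear injection `equiv ∘ inl` of the slice condition; charts of the maximal
  atlas have bijective manifold derivative (`Literature.Topology.FourManifolds.mdifferentiable_of_mem_maximalAtlas'`,
  Mathlib's `OpenPartialHomeomorph.MDifferentiable.mfderiv_injective`). Lee, *Introduction to
  Smooth Manifolds* (2013), Prop. 4.1 and Thm. 4.14 (rank of an immersion).
* `Literature.Topology.FourManifolds.det_mfderiv_ne_zero_of_isImmersionAt` — in codimension `0`
  (same model vector space) the Jacobian determinant of an immersion vanishes nowhere; hence
  `Literature.Topology.FourManifolds.IsOrientable.of_isImmersion`,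
  `Literature.Topology.FourManifolds.IsOrientable.of_isSmoothEmbedding`: **an orientation pulls
  back along a codimension-`0` immersion / smooth embedding** (`SmoothOrientation.comapOfDetNeZero`
  of `RegularLevelSplitting.lean`; Hirsch, *Differential Topology* (1976), §4.4, p. 101), e.g.
  along the inclusion of a regular sublevel set of a manifold with boundary.
* `Literature.Topology.FourManifolds.mhessian_apply_self_nonneg_of_isLocalMin_of_isInteriorPoint`,
  `Literature.Topology.FourManifolds.morseIndex_eq_zero_of_isLocalMin_of_isInteriorPoint` — **an
  interior local minimum has Morse index `0`** (the tree's `IsLocalMin.morseIndex_eq_zero`,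
  `MorseExtrema.lean`, is stated for boundaryless models; at an interior point `range I` is a
  neighbourhood of the chart value and the within-derivatives are plain derivatives).
  Milnor, *Morse theory* (1963), §2.
* `Literature.Topology.FourManifolds.IsMorseAdapted.isConnected_preimage_Iic` — **for a Morse
  function adapted to the boundary of a compact manifold with at most one critical point of index
  `0`, every nonempty sublevel set `{f ≤ a}`, `a < 1`, is connected**: were it the disjoint union
  of two closed pieces, minimising `f` on each would produce two local minima of `f`, interior
  (as `f = 1` on the boundary) hence critical of index `0` (Reeb's argument; Milnor (1963), proof
  of Thm. 4.1; the tree's `Literature.Topology.FourManifolds.isConnected_preimage_Iic` is the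
  boundaryless case).

## References

* J. M. Lee, *Introduction to Smooth Manifolds*, 2nd ed., GTM 218 (2013), Prop. 4.1, Thm. 4.14,
  Ch. 15 (pullback orientations). [LeeSmoothManifolds2013]
* M. W. Hirsch, *Differential Topology*, GTM 33 (1976), §4.4, p. 101. [HirschDT1976]
* J. Milnor, *Morse theory*, Ann. of Math. Studies 51 (1963), §2 and proof of Thm. 4.1.
  [Milnor1963]
-/

open scoped Manifold ContDiff Topology
open Set Function Filter

noncomputable section

namespace Literature.Topology.FourManifolds

/-! ### Immersions have injective differential, also at boundary points -/

section Immersion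

variable {E E' F H G : Type*} [NormedAddCommGroup E] [NormedSpace ℝ E]
  [NormedAddCommGroup E'] [NormedSpace ℝ E'] [NormedAddCommGroup F] [NormedSpace ℝ F]
  [TopologicalSpace H] [TopologicalSpace G]
  {I : ModelWithCorners ℝ E H} {J : ModelWithCorners ℝ E' G}
  {M : Type*} [TopologicalSpace M] [ChartedSpace H M]
  {N : Type*} [TopologicalSpace N] [ChartedSpace G N]
  {f : M → N} {x : M}

/-- **The differential of a `C^∞` immersion (with chosen complement) is injective**, for
arbitrary models with boundary or corners. Near `x`, `f = ψ⁻¹ ∘ g ∘ φ` for the slice charts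
`φ`, `ψ` of the maximal atlases and `g = ψ ∘ f ∘ φ⁻¹ : H → G`, which reads `equiv ∘ (·, 0)`
between the models, so `df_x = d(ψ⁻¹) ∘ (equiv ∘ inl) ∘ dφ` is a composite of injections
(charts of the maximal atlas have bijective differential). The primed name avoids the tree's
boundaryless `mfderiv_injective_of_isImmersionAtOfComplement`. Lee, *Introduction to Smooth
Manifolds* (2013), Prop. 4.1. [folklore] -/
theorem injective_mfderiv_of_isImmersionAtOfComplement'
    (h : Manifold.IsImmersionAtOfComplement F I J ∞ f x) : Injective (mfderiv I J f x) := by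
  set φ := h.domChart with hφdef
  set ψ := h.codChart with hψdef
  have hφ : φ ∈ IsManifold.maximalAtlas I ∞ M := h.domChart_mem_maximalAtlas
  have hψ : ψ ∈ IsManifold.maximalAtlas J ∞ N := h.codChart_mem_maximalAtlas
  have hxφ : x ∈ φ.source := h.mem_domChart_source
  have hfx : f x ∈ ψ.source := h.mem_codChart_source
  have hψx : ψ (f x) ∈ ψ.target := ψ.map_source hfx
  -- the map in the slice charts, as a map between the model spaces
  set g : H → G := ψ ∘ f ∘ φ.symm with hg
  have hgx : g (φ x) = ψ (f x) := by simp [hg, φ.left_inv hxφ]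
  -- `f = ψ⁻¹ ∘ g ∘ φ` near `x`
  have heq : f =ᶠ[𝓝 x] (ψ.symm ∘ g ∘ φ) := by
    filter_upwards [φ.open_source.mem_nhds hxφ] with y hy
    have hy' : f y ∈ ψ.source := h.source_subset_preimage_source hy
    simp only [hg, comp_apply, φ.left_inv hy, ψ.left_inv hy']
  -- the charts are differentiable with bijective differential
  have hφd : φ.MDifferentiable I I := mdifferentiable_of_mem_maximalAtlas' hφ
  have hψd : ψ.MDifferentiable J J := mdifferentiable_of_mem_maximalAtlas' hψ
  have D1 : HasMFDerivAt I I φ x (mfderiv I I φ x) := (hφd.mdifferentiableAt hxφ).hasMFDerivAt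
  have D3 : HasMFDerivAt J J ψ.symm (g (φ x)) (mfderiv J J ψ.symm (ψ (f x))) := by
    rw [hgx]
    exact (hψd.mdifferentiableAt_symm hψx).hasMFDerivAt
  -- the differential of `g` at `φ x` is the linear injection of the slice condition
  set L : E →L[ℝ] E' := (h.equiv : (E × F) →L[ℝ] E').comp (ContinuousLinearMap.inl ℝ E F)
    with hL
  have hzt : I (φ x) ∈ (φ.extend I).target := by
    have := (φ.extend I).map_source (x := x) (by simpa [φ.extend_source] using hxφ)
    simpa [φ.extend_coe] using this
  have hval : ∀ z ∈ (φ.extend I).target, (J ∘ g ∘ I.symm) z = (h.equiv ∘ fun u : E => (u, (0 : F))) z := by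
    intro z hz
    have := h.writtenInCharts hz
    simpa [hg, OpenPartialHomeomorph.extend_coe, OpenPartialHomeomorph.extend_coe_symm] using this
  have D2 : HasMFDerivAt I J g (φ x) L := by
    refine ⟨?_, ?_⟩
    · have hc1 : ContinuousAt φ.symm (φ x) := φ.continuousAt_symm (φ.map_source hxφ)
      have hc2 : ContinuousAt f (φ.symm (φ x)) := by
        rw [φ.left_inv hxφ]; exact h.continuousAt
      have hc3 : ContinuousAt ψ (f (φ.symm (φ x))) := by
        rw [φ.left_inv hxφ]; exact ψ.continuousAt hfx
      have hc : ContinuousAt (ψ ∘ (f ∘ φ.symm)) (φ x) :=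
        ContinuousAt.comp (f := f ∘ φ.symm) hc3 (hc2.comp hc1)
      exact hc
    · have hw : writtenInExtChartAt I J (φ x) g = J ∘ g ∘ I.symm := by
        funext z
        simp [writtenInExtChartAt]
      have hpt : extChartAt I (φ x) (φ x) = I (φ x) := rfl
      rw [hw, hpt]
      have hlin : HasFDerivWithinAt (h.equiv ∘ fun u : E => (u, (0 : F))) L (range I) (I (φ x)) := by
        have h1 : HasFDerivAt (fun u : E => (u, (0 : F))) (ContinuousLinearMap.inl ℝ E F) (I (φ x)) :=
          hasFDerivAt_prodMk_left (I (φ x)) (0 : F)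
        exact ((h.equiv : (E × F) →L[ℝ] E').hasFDerivAt.comp _ h1).hasFDerivWithinAt
      refine hlin.congr_of_eventuallyEq ?_ (hval _ hzt)
      have hmem : (φ.extend I).target ∈ 𝓝[range I] (I (φ x)) := by
        have := φ.extend_target_mem_nhdsWithin (I := I) hxφ
        simpa [φ.extend_coe] using this
      filter_upwards [hmem] with z hz
      exact hval z hz
  -- chain rule and conclusion
  have D : HasMFDerivAt I J (ψ.symm ∘ g ∘ φ) x
      ((mfderiv J J ψ.symm (ψ (f x))).comp (L.comp (mfderiv I I φ x))) :=
    (D3.comp (φ x) D2).comp x D1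
  have Df : HasMFDerivAt I J f x
      ((mfderiv J J ψ.symm (ψ (f x))).comp (L.comp (mfderiv I I φ x))) :=
    D.congr_of_eventuallyEq heq
  rw [Df.mfderiv]
  have i1 : Injective (mfderiv I I φ x) := hφd.mfderiv_injective hxφ
  have i3 : Injective (mfderiv J J ψ.symm (ψ (f x))) := hψd.symm.mfderiv_injective hψx
  have i2 : Injective L := by
    intro a b hab
    have := h.equiv.injective hab
    simpa using this
  exact i3.comp (i2.comp i1)

/-- **The differential of a `C^∞` immersion is injective**, at boundary points too
(`injective_mfderiv_of_isImmersionAtOfComplement'` for the chosen complement).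
Lee (2013), Prop. 4.1. [folklore] -/
theorem injective_mfderiv_of_isImmersionAt' (h : Manifold.IsImmersionAt I J ∞ f x) :
    Injective (mfderiv I J f x) := by
  obtain ⟨F', _, _, h⟩ := h
  exact injective_mfderiv_of_isImmersionAtOfComplement' h

end Immersion

/-! ### Codimension `0`: nonvanishing Jacobian, pullback of orientations -/

section Orientation

variable {E H G : Type*} [NormedAddCommGroup E] [NormedSpace ℝ E] [FiniteDimensional ℝ E]
  [TopologicalSpace H] [TopologicalSpace G]
  {I : ModelWithCorners ℝ E H} {J : ModelWithCorners ℝ E G}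
  {M : Type*} [TopologicalSpace M] [ChartedSpace H M]
  {N : Type*} [TopologicalSpace N] [ChartedSpace G N]
  {f : M → N}

/-- **In codimension `0` the Jacobian determinant of an immersion vanishes nowhere**: an
injective linear endomorphism of a finite-dimensional space is invertible. [folklore] -/
theorem det_mfderiv_ne_zero_of_isImmersionAt {x : M} (h : Manifold.IsImmersionAt I J ∞ f x) :
    LinearMap.det (M := E) (mfderiv I J f x).toLinearMap ≠ 0 := by
  set A : E →ₗ[ℝ] E := (mfderiv I J f x).toLinearMap with hA
  have hinj : Injective A := injective_mfderiv_of_isImmersionAt' h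
  have hunit : IsUnit A := (LinearMap.isUnit_iff_ker_eq_bot A).2 (LinearMap.ker_eq_bot.2 hinj)
  exact ((LinearMap.isUnit_iff_isUnit_det A).1 hunit).ne_zero

variable [IsManifold I 1 M] [IsManifold J 1 N]

/-- **Orientations pull back along codimension-`0` immersions**: if `f : M → N` is a `C^∞`
immersion between manifolds on the same model vector space and `N` is orientable, so is `M`
(pull an orientation back by the sign of the Jacobian determinant,
`SmoothOrientation.comapOfDetNeZero`). Hirsch, *Differential Topology* (1976), §4.4, p. 101
(induced orientation on a codimension-`0` immersed manifold); Lee (2013), Prop. 15.5 ff.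
[cite: HirschDT1976, §4.4 p. 101] -/
theorem IsOrientable.of_isImmersion (hf : Manifold.IsImmersion I J ∞ f) (hN : IsOrientable J N) :
    IsOrientable I M := by
  obtain ⟨oN⟩ := hN
  exact ⟨oN.comapOfDetNeZero f hf.contMDiff (by simp) fun x =>
    det_mfderiv_ne_zero_of_isImmersionAt (hf.isImmersionAt x)⟩

/-- **Orientations pull back along codimension-`0` smooth embeddings** (e.g. the inclusion of a
compact codimension-`0` submanifold with boundary, such as a regular sublevel set).
Hirsch (1976), §4.4, p. 101. [cite: HirschDT1976, §4.4 p. 101] -/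
theorem IsOrientable.of_isSmoothEmbedding (hf : Manifold.IsSmoothEmbedding I J ∞ f)
    (hN : IsOrientable J N) : IsOrientable I M :=
  IsOrientable.of_isImmersion hf.isImmersion hN

end Orientation

/-! ### Interior local minima have Morse index `0` -/

section LocalMin

variable {E H : Type*} [NormedAddCommGroup E] [NormedSpace ℝ E] [TopologicalSpace H]
  {I : ModelWithCorners ℝ E H} {M : Type*} [TopologicalSpace M] [ChartedSpace H M]

/-- **The Hessian at an interior local minimum is positive semidefinite** (for `f` of class `C²`
at the point; any model with boundary or corners). At an interior point `range I` is a
neighbourhood of the chart value, so the within-`range I` derivatives defining `mhessian` are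
ordinary derivatives and the second-order necessary condition for a minimum applies
(`IsLocalMin.fderiv_fderiv_apply_self_nonneg`). Milnor, *Morse theory* (1963), §2. [folklore] -/
theorem mhessian_apply_self_nonneg_of_isLocalMin_of_isInteriorPoint {f : M → ℝ} {x : M}
    (hf : ContMDiffAt I 𝓘(ℝ, ℝ) 2 f x) (h : IsLocalMin f x) (hx : I.IsInteriorPoint x) (v : E) :
    0 ≤ mhessian I f x v v := by
  have hnhds : range I ∈ 𝓝 (extChartAt I x x) := range_mem_nhds_isInteriorPoint hx
  have hint : interior (range I) ∈ 𝓝 (extChartAt I x x) := isOpen_interior.mem_nhds hx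
  set g := writtenInExtChartAt I 𝓘(ℝ, ℝ) x f with hg
  have h2 : ContDiffAt ℝ 2 g (extChartAt I x x) := ((contMDiffAt_iff.1 hf).2).contDiffAt hnhds
  have key := IsLocalMin.fderiv_fderiv_apply_self_nonneg h2
    (isLocalMin_writtenInExtChartAt (I := I) h) v
  have hev : fderivWithin ℝ g (range I) =ᶠ[𝓝 (extChartAt I x x)] fderiv ℝ g := by
    filter_upwards [hint] with z hz
    exact fderivWithin_of_mem_nhds (mem_interior_iff_mem_nhds.1 hz)
  have hdef : mhessian I f x v v =
      fderivWithin ℝ (fderivWithin ℝ g (range I)) (range I) (extChartAt I x x) v v := rfl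
  rw [hdef, fderivWithin_of_mem_nhds hnhds, hev.fderiv_eq]
  exact key

/-- **An interior local minimum has Morse index `0`**: the Hessian there is positive
semidefinite, so it is negative definite on no nonzero subspace. Milnor, *Morse theory* (1963),
§2 (the index is the dimension of a maximal negative definite subspace). [cite: Milnor1963, §2] -/
theorem morseIndex_eq_zero_of_isLocalMin_of_isInteriorPoint [FiniteDimensional ℝ E] {f : M → ℝ}
    {x : M} (hf : ContMDiffAt I 𝓘(ℝ, ℝ) 2 f x) (h : IsLocalMin f x) (hx : I.IsInteriorPoint x) :
    morseIndex I f x = 0 := by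
  have hnn : ∀ v, 0 ≤ (mhessian I f x).toQuadraticMap v := fun v => by
    rw [LinearMap.BilinMap.toQuadraticMap_apply]
    exact mhessian_apply_self_nonneg_of_isLocalMin_of_isInteriorPoint hf h hx v
  have key := QuadraticForm.sigPos_add_finrank_le_of_nonpos
    (Q := -(mhessian I f x).toQuadraticMap) (V := ⊤)
    (fun v _ => by rw [QuadraticMap.neg_apply, neg_nonpos]; exact hnn v)
  rw [finrank_top, sigPos_neg] at key
  unfold morseIndex
  omega

end LocalMin

/-! ### Sublevel sets with a single minimum are connected -/

section Connected

variable {E H : Type*} [NormedAddCommGroup E] [NormedSpace ℝ E] [TopologicalSpace H]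
  {I : ModelWithCorners ℝ E H} {M : Type*} [TopologicalSpace M] [ChartedSpace H M]

omit [ChartedSpace H M] in
/-- A minimiser of `f` on a closed-open piece of a set `S` off which `f` is not smaller is a
local minimum of `f`: if `S ⊆ u ∪ v` with `v` closed and `S ∩ u ∩ v = ∅`, a point of `S ∩ u`
minimising `f` there minimises `f` on the neighbourhood `vᶜ`. [folklore] -/
theorem isLocalMin_of_isMinOn_inter {f : M → ℝ} {S u v : Set M} (hv : IsClosed v)
    (huv : S ⊆ u ∪ v) (hdisj : S ∩ (u ∩ v) = ∅) {m : M} (hm : m ∈ S ∩ u)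
    (hout : ∀ y, y ∉ S → f m ≤ f y) (hmin : IsMinOn f (S ∩ u) m) : IsLocalMin f m := by
  have hmv : m ∉ v := fun hmv => by
    have : m ∈ S ∩ (u ∩ v) := ⟨hm.1, hm.2, hmv⟩
    rw [hdisj] at this
    exact this
  refine Filter.mem_of_superset (hv.isOpen_compl.mem_nhds hmv) fun y hy => ?_
  show f m ≤ f y
  by_cases hyS : y ∈ S
  · exact hmin ⟨hyS, (huv hyS).resolve_right hy⟩
  · exact hout y hyS

/-- **A nonempty sublevel set `{f ≤ a}`, `a < 1`, of a Morse function adapted to the boundary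
of a compact manifold with at most one critical point of index `0` is connected.** If it split
into two nonempty closed pieces, minimising `f` on each piece would give two local minima of
`f`; they are interior points (`f = 1 > a` on the boundary), hence critical points
(`Literature.Topology.FourManifolds.isMCriticalPt_of_isLocalMin`) of index `0`
(`morseIndex_eq_zero_of_isLocalMin_of_isInteriorPoint`). Reeb's argument: Milnor, *Morse theory*
(1963), proof of Thm. 4.1; for boundaryless `M` this is the tree's
`Literature.Topology.FourManifolds.isConnected_preimage_Iic`.
[cite: Milnor1963, §3 and proof of Thm. 4.1] -/
theorem IsMorseAdapted.isConnected_preimage_Iic [FiniteDimensional ℝ E] [CompactSpace M]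
    {f : M → ℝ} (hf : IsMorseAdapted I f) (h0 : (criticalSetOfIndex I f 0).Subsingleton)
    {a : ℝ} (ha : a < 1) (hne : (f ⁻¹' Iic a).Nonempty) : IsConnected (f ⁻¹' Iic a) := by
  refine ⟨hne, ?_⟩
  have hcont : Continuous f := hf.1.1.continuous
  have hclosed : IsClosed (f ⁻¹' Iic a) := isClosed_Iic.preimage hcont
  have hint : ∀ m, f m ≤ a → I.IsInteriorPoint m := fun m hm => by
    rcases I.isInteriorPoint_or_isBoundaryPoint m with h | h
    · exact h
    · exact absurd (hf.2.1 m h).1 (by linarith)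
  rw [isPreconnected_iff_subset_of_disjoint_closed]
  intro u v hu hv huv hdisj
  by_contra hcon
  rw [not_or] at hcon
  obtain ⟨hSu, hSv⟩ := hcon
  obtain ⟨xv, hxvS, hxvu⟩ := not_subset.1 hSu
  obtain ⟨xu, hxuS, hxuv⟩ := not_subset.1 hSv
  have hxv : xv ∈ v := (huv hxvS).resolve_left hxvu
  have hxu : xu ∈ u := (huv hxuS).resolve_right hxuv
  have key : ∀ (u v : Set M), IsClosed u → IsClosed v → f ⁻¹' Iic a ⊆ u ∪ v →
      f ⁻¹' Iic a ∩ (u ∩ v) = ∅ → (f ⁻¹' Iic a ∩ u).Nonempty →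
      ∃ m ∈ f ⁻¹' Iic a ∩ u, m ∈ criticalSetOfIndex I f 0 := by
    intro u v hu hv huv hdisj hne
    obtain ⟨m, hm, hmin⟩ := (hclosed.inter hu).isCompact.exists_isMinOn hne hcont.continuousOn
    have hout : ∀ y, y ∉ f ⁻¹' Iic a → f m ≤ f y := fun y hy =>
      (show f m ≤ a from hm.1).trans (le_of_lt (not_le.1 hy))
    have hloc : IsLocalMin f m := isLocalMin_of_isMinOn_inter hv huv hdisj hm hout hmin
    have hmi : I.IsInteriorPoint m := hint m hm.1
    exact ⟨m, hm, isMCriticalPt_of_isLocalMin hloc hmi,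
      morseIndex_eq_zero_of_isLocalMin_of_isInteriorPoint (hf.isMorse.contMDiffAt_two m) hloc hmi⟩
  obtain ⟨m, hm, hmc⟩ := key u v hu hv huv hdisj ⟨xu, hxuS, hxu⟩
  obtain ⟨m', hm', hm'c⟩ := key v u hv hu (by rwa [union_comm]) (by rwa [inter_comm v u])
    ⟨xv, hxvS, hxv⟩
  have hmm' : m = m' := h0 hmc hm'c
  have : m ∈ f ⁻¹' Iic a ∩ (u ∩ v) := ⟨hm.1, hm.2, hmm' ▸ hm'.2⟩
  rw [hdisj] at this
  exact this

end Connected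

end Literature.Topology.FourManifolds
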